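import Mathlib
import HarnessLib
import HarnessLib.Audit
import Summits.CriticalPhenomena.Statement
import Literature.Probability.LatticeModels.CriticalAxisRatioRegularity
import HarnessLib.Audit.Status.Attr

/-!
Route: ThresholdDilation

DORMANT since 2026-08-22T03:39:47Z (reconciler: no traction for 5 d (last activity item-evidence-added at 2026-08-17T02:18:32Z); parked, not closed — `ledger route dormant route-CriticalPhenomena-ThresholdDilation --off` to reactivate) — unstaffed, not closed; items shared with open routes are served there. `ledger route dormant <id> --off` reactivates.

# Route ThresholdDilation — criticality is a threshold — implement x↦2x at the bottom of the
transfer-operator spectrum and read off η and all-scale doubling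

CRITICALITY IS A THRESHOLD (idea card dilation-conjugate-operator-threshold, its engine (M0)–(M3)
made typable). Along e₀ the
critical n.n. Ising state on ℤ³ is realised on a Hilbert space by a positive transfer contraction T
= e^{−H} and time-zero spin
vectors ψ_A, ⟪ψ_A, Tⁿψ_B⟫ = ⟨σ_A σ_{B+ne₀}⟩⁺_{β_c(3)} (A, B finite subsets of the plane x₀ = 0);
then g(n) := ⟨σ₀σ_{ne₀}⟩_{β_c} =
⟪ψ, Tⁿψ⟫ = ∫₀¹ λⁿ dν(λ) is the Laplace transform of the spectral measure of the spin at the BOTTOM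
of spec H, so "η exists" and
"every scale doubles" (items 0635, 0667) are threshold-regularity statements about ν (Glimm–Jaffe's
dictionary). It suffices to show
X = (R) ∧ (V) ∧ (C): (R) TwoPlaneTransferRealisation — such (T, ψ) exist on ℓ²(ℕ) (RP transfer
matrix; known, unproved in tree;
filed FIRST); (V) ThresholdDilationImplementer — THE ENGINE: the dilation x ↦ 2x is implementable at
low energy on the spin: a bounded V with
V T^m ψ ≈ T^{2m} V ψ, near-isometric on the vectors T^m ψ = e^{−mH}ψ, and V ψ ≈ 2^{Δ} ψ after the
low-pass filter T^{2m}
(σ quasi-primary of weight Δ), all with relative errors → 0 as m → ∞ — the integrated (Egorov) form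
of a homogeneous Mourre estimate
i[H, A] = (log 2)·H + o(H) at the threshold with the lattice dilation as conjugate operator; (C)
ConformalLimitOfDyadicLaw — the
conjunct given the two-point dyadic scaling law (imported complement, lowest rank). Glue (support
DyadicLawOfImplementer, provable
now): (R) ∧ (V) ⇒ DyadicScalingLaw, g(2n)·4^Δ/g(n) → 1, by three triangle inequalities and the
log-convexity of m ↦ ‖T^m ψ‖²;
dividends (supports): η exists in the log sense (item 0635) and all-scale doubling, hence item
0667's non-degeneracy transfer.
Lean: `TwoPlaneTransferRealisation ∧ ThresholdDilationImplementer ∧ ConformalLimitOfDyadicLaw`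

## Assembly
Pure logic (term `assembly_glue` in the planner's Sketch.lean, rc 0): from (R) and (V) the glue
support DyadicLawOfImplementer yields
DyadicScalingLaw; the imported complement (C) turns it into Ising3DConformalLimit (root abbrev of
Literature.Probability.LatticeModels.CritIsing3DConformalLimit). Every antecedent is load-bearing:
(R) and (V) feed the glue, the
glue feeds (C). DyadicScalingLaw is an intermediate node (closable directly, e.g. from 0634, which
would moot (V) for THIS assembly and
leave it as the operator-theoretic dividend); EtaOfDyadicLaw / NondegeneracyOfDoubling /
AxisKallenLehmann are dividends outside the chain.
Decls are referenced by their fully qualified names (same file, rendered above the assembly).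

Rationale: WHY THIS LINE. Imported area, with an explicit dictionary: threshold spectral/scattering theory
(Mourre1981; the threshold Mourre estimates with the
DILATION generator as conjugate operator, i[H_f, D] = H_f exact plus perturbation, dyadic-shell
limiting absorption down to the
threshold: BachEtAl1999, FrohlichGriesemerSigal2011) + Osterwalder–Schrader/transfer-matrix
reconstruction (GlimmJaffe1987 §6.1,
in tree as Literature.Probability.LatticeModels.TransferData / IsOSRealisation; the Ising spectral
representation GlimmJaffe1976
Prop 2.2, AizenmanDuminilCopinAnnals2021 Prop 5.3) + Tauberian theory (Karamata;
DehaanStadtmuller1985): H = −log T, ψ = σ̂₀Ω,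
g = Laplace transform of ν, all-scale doubling of g = dyadic doubling of ν at the top of [0,1],
scale covariance = the intertwining
V T = T² V, primarity of σ = V ψ ≈ 2^{Δ} ψ at low energy. All five open routes on the sub attack
covariance or U₄ and ASSUME the two-point spine (items 0634/0635/0667: η, doubling,
ρ(δ) = δ^{−Δ}); the rigorous two-point toolbox provably cannot supply it — Källén–Lehmann-positive
crossover cascades pass RP, MMS,
the infrared window and DC–Panis yet break doubling (card crossover-witness-no-doubling; refuter
note on 0667), log-periodic kernels
are RP in every plane (card rp-cannot-fix-the-scale-log-periodic). This line adds exactly the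
structure those witnesses lack: an
operator on the SAME Hilbert space intertwining one transfer step with two; a spectral staircase (a
nearly-massless Yukawa component
riding on the critical background) admits no such V. Versus the card: its literal (Q)
"Aψ = iΔ′ψ + χ" contradicts self-adjointness and its A presupposes a local Hamiltonian that −log T
on ℤ³ lacks (auditor's model
slip); both are repaired by the bounded, integrated, low-pass-filtered form, existential in V on the
OS space of the ACTUAL ℤ³ model —
the energy-current-moment construction (KooSaleur1994, MilstedVidal2017 one dimension up) with the
second-commutator/rescaled-shell
regularity the auditor asked for becomes the layer-2 route to (V), not a hypothesis of it.
Prior programme (docs/m5/inspiration): not read (plancard mode).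

RANKED CRUXES. #2 TwoPlaneTransferRealisation (crux) — (R) TWO-PLANE TRANSFER REALISATION (card M0;
the unproved cone fact everything rests on — a known theorem, filed FIRST by the plancard rule): on
ℓ²(ℕ;ℂ) there are a positive contraction T (‖T‖ ≤ 1, T ≥ 0, hence self-adjoint) and vectors ψ_A, A
ranging over finite subsets of the time-zero plane {x₀ = 0} ≅ ℤ², such that ⟪ψ_A, Tⁿ ψ_B⟫ = ⟨σ_A ·
σ_{B + n e₀}⟩⁺_{β_c(3),0} for all A, B, n (plusCorr of the symmetric difference of A × {0} and B ×
{n}, σ² = 1). This is the Osterwalder–Schrader space of the critical state for the site reflection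
x₀ ↦ −x₀ (positivity of the form), T the unit shift, T ≥ 0 by the bond reflection x₀ ↦ 1 − x₀ (n.n.
Ising has both: FILS 1978; in tree on tori isingTorus_reflectionPositive_sites/bonds_holds),
embedded in separable ℓ². With A = B = {0} it contains the axis Källén–Lehmann representation g(n) =
∫₀¹ λⁿ dν (support AxisKallenLehmann). Proof route: GNS/RKHS completion of the RP kernel, T :=
shift, torus → ℤ³ → β_c by weak limits (positivity is closed; plus = free state at β_c, ADS2015).
[difficulty: L] (why it might fail: A known theorem unproved in tree: T ≥ 0 needs BOTH site- and
bond-reflection positivity of the infinite-volume state at β_c(3) exactly (torus RP → thermodynamic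
limit → β↑β_c via continuity/uniqueness, ADS2015) plus a GNS/RKHS completion into ℓ²; with one RP
only, T ≥ 0 fails.) [GlimmJaffe1987 §6.1 Thm 6.1.3, GlimmJaffe1976 Prop 2.2 (spectral representation
for the transfer matrix), FrohlichIsraelLiebSimon1978 §2–3, AizenmanDuminilCopinAnnals2021 Prop 5.3
(arXiv:1912.07973 p.17), Literature.Probability.LatticeModels.IsOSRealisation,
Literature.Probability.LatticeModels.isingTorus_reflectionPositive_sites_holds,
Literature.Probability.LatticeModels.isingTorus_reflectionPositive_bonds_holds]
#3 ThresholdDilationImplementer (crux) — (V) THRESHOLD DILATION IMPLEMENTER — the engine (card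
M1+M2+M3 in integrated form; the hardest and most informative item; ranked 3 only because (R) must
land first). For EVERY realisation (T, ψ_·) as in (R), with ψ := ψ_{{0}} = σ̂₀Ω the spin at the
origin, there are a bounded operator V on ℓ² and Δ > 0 such that for every ε > 0, eventually in m:
(Iso) |‖V T^m ψ‖ − ‖T^m ψ‖| ≤ ε ‖T^m ψ‖ (V is nearly isometric on the low-energy vectors T^m ψ =
e^{−mH}ψ); (Int) ‖V T^m ψ − T^{2m} V ψ‖ ≤ ε ‖T^m ψ‖ (V intertwines one transfer step with two: the
Egorov/integrated form of i[H, A] = (log 2)·H + o(H), V ≈ e^{iA} implementing x ↦ 2x at low energy);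
(QP) ‖T^{2m}(V ψ − 2^{Δ} ψ)‖ ≤ ε ‖T^{2m} ψ‖ (after low-pass filtering the dilated spin is 2^Δ times
the spin: σ is quasi-primary of weight Δ — the consistent form of the card's (Q), whose literal 'Aψ
= iΔ′ψ + χ' contradicts self-adjointness). Existential in V on the OS space of the ACTUAL ℤ³ model:
no local Hamiltonian or energy current is presupposed (that construction is layer 2). Deliberately
stated for the single spin: for a FIXED lattice set A with |A| ≥ 2 the analogous clauses (V ψ_A ≈
2^{|A|Δ} ψ_{2A}) would force exact scaling identities among lattice-scale fusion amplitudes (and,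
for even |A|, G(y) = 4^Δ G(2y) exactly through the vacuum component) — false; the n-point form needs
A dilated WITH m (Two-layer plan). Not vacuous: V = 0 violates (QP), V = 1 violates (Int) at Δ ≥ 1/2
(‖T^mψ − T^{2m}ψ‖² ≈ 0.17 g(2m)); ⟨σ₀⟩⁺_{β_c} = 0 (ADS2015) keeps every clause asymptotic. [deps:
TwoPlaneTransferRealisation] [difficulty: open-problem] (why it might fail: No lattice symmetry x↦2x
exists: V must be BUILT (Mourre conjugate operator from the energy-current first moment, or block
spin at the fixed point) and needs a genuine scaling limit (no limit cycle), a gap above Δ_σ in the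
odd spectrum and corrections-to-scaling → 0 — all open on ℤ³.) [Mourre1981, BachEtAl1999 (threshold
Mourre estimate with the dilation generator whose commutator with H_f is H_f),
FrohlichGriesemerSigal2011 (spectral RG: LAP uniformly on rescaled dyadic shells),
doi:10.1007/978-3-662-14145-8_18 (Boutet de Monvel–Măntoiu: weakly conjugate operator),
KooSaleur1994, MilstedVidal2017 (lattice conformal generators from energy-current moments in 1+1D),
SchulerEtAl2016 (2+1D critical transfer-matrix/torus spectrum = CFT operator content), idea card
Summits/CriticalPhenomena/Ising3DConformalLimit/Ideas/dilation-conjugate-operator-threshold.md]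
#4 DyadicScalingLaw (crux) — DYADIC SCALING LAW of the critical two-point function along the axis
(the hinge; output (O3) of the card in its honest, discrete form): there is Δ > 0 with g(2n)·4^Δ /
g(n) → 1 as n → ∞, g(n) = ⟨σ₀σ_{ne₀}⟩⁺_{β_c(3)} = criticalTwoPoint 3 (n e₀). It implies η EXISTS in
the log sense, η = 2Δ − 1 (item 0635; support EtaOfDyadicLaw) and ALL-SCALE DOUBLING g(2n) ≥ κ g(n)
(⇒ item 0667, support NondegeneracyOfDoubling); it is implied by the pure power law 0634 and by (R)
∧ (V) (support DyadicLawOfImplementer). It does NOT assert regular variation g(λn)/g(n) → λ^{−2Δ}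
for all λ (a log-periodic modulation of period log 2 survives; the factor-3 twin of (V) kills it,
Two-layer plan). Numerical target: 4^{−Δ} = 0.48757, corrections ∝ n^{−0.83}. [difficulty:
open-problem] (why it might fail: Nothing two-point-shaped proves it: KL-positive crossover cascades
pass RP, MMS, IR and DC–Panis bounds yet break doubling (card crossover-witness-no-doubling; item
0667 notes); in print only regular scales are abundant (arXiv:1912.07973 Thm 5.12). Numerically the
limit is 1 (4^-Δ≈0.4876).) [AizenmanDuminilCopinAnnals2021 §5.6 and Thm 5.12 (arXiv:1912.07973 p.20:
regular scales abundant while all-scale regularity is open), DuminilcopinPanis2025 Thm 1.3 and Thm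
1.5 (arXiv:2404.05700), stmt-CriticalPhenomena-0667 (refuter notes: doubling not derivable from
RP/GKS/MMS), stmt-CriticalPhenomena-0635, PolandRychkovVichi2019 (Δ_σ = 0.5181489),
Literature.Probability.LatticeModels.criticalTwoPoint_bounds_holds]
#5 ConformalLimitOfDyadicLaw (crux) — (C) IMPORTED COMPLEMENT (lowest rank; this route does not
attack it): the two-point dyadic scaling law implies the conjunct Ising3DConformalLimit — i.e. given
the two-point spine (η, doubling, hence the admissible renormalisation ρ(δ) := g(⌊1/δ⌋)^{−1/2} with
δ^{−Δ} behaviour in the log sense, tightness and non-degeneracy transfer of subsequential limits),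
supply existence of the full pointwise limit, O(3) invariance, inversion covariance and U₄ ≢ 0. ONE
implication, so that whoever proves it may USE the dyadic law; its decomposition is owned by the
covariance/U₄ routes (HyperoctahedralRP isotropy; InversionUpgradeNormalised; item 0636; card
mirror-hoelder-modulus for doubling ⇒ equicontinuity ⇒ subsequential limits) — see Two-layer plan.
[deps: DyadicScalingLaw] [difficulty: open-problem] (why it might fail: It is the conjunct given
only the two-point dyadic law: existence of all n-point limits, O(3) and inversion covariance and
U₄≢0 stay open (ICM22 §8.4) and meet ScaleCovarianceNotMoebius/LiouvilleRigidity unmitigated;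
imported from HyperoctahedralRP, IsingEuclidUpgrade, AnomalousForces.) [DuminilCopinICM2022 §8.1
p.25 and §8.4 p.29, PolandRychkovVichi2019 §II eq. (2),
Literature.Barriers.CriticalPhenomena.ScaleCovarianceNotMoebius,
Literature.Barriers.CriticalPhenomena.LiouvilleRigidity, stmt-CriticalPhenomena-0636,
stmt-CriticalPhenomena-1344, stmt-CriticalPhenomena-1982]
#9 DyadicLawOfImplementer (support) — GLUE (provable now, ~0.5–1 kLoC): (R) → (V) →
DyadicScalingLaw. Proof: take (T, ψ_·) from (R), ψ := ψ_{{0}}, and (V, Δ) from (V) (weight a = 2^Δ >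
1); with u_m := T^m ψ, w_m := T^{2m} ψ the three inequalities give (a − ε)‖w_m‖ ≤ (1 + 2ε)‖u_m‖ and
(1 − 2ε)‖u_m‖ ≤ (a + ε)‖w_m‖, so ‖u_m‖²/(a²‖w_m‖²) = g(2m)/(4^Δ g(4m)) → 1 (‖T^m ψ‖² = ⟪ψ, T^{2m}ψ⟫
= g(2m) by (R) with A = B = {0}: plusCorr {0, 2m e₀} = criticalTwoPoint 3 (2m e₀) via
spinProduct/spinPair and Matrix.vecCons k 0 = Pi.single 0 k). Odd arguments: m ↦ g(2m) = ‖T^m ψ‖² is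
log-convex (Cauchy–Schwarz), so g(2m+2)/g(2m) is non-decreasing, ≤ 1 (MMS axis monotonicity
twoPointPlus_add_single_le) and converges to 1 since g(n) ≥ c n^{−2} (criticalTwoPoint_bounds_holds)
forbids exponential decay; hence g(n+1)/g(n) → 1 and g(4m+2)/g(2m+1) → 4^{−Δ}. No Tauberian theorem
needed. [difficulty: provable-now] [idea card dilation-conjugate-operator-threshold (M3: the
self-contained functional-analytic lemma),
Literature.Probability.LatticeModels.criticalTwoPoint_bounds_holds,
Literature.Probability.LatticeModels.twoPointPlus_add_single_le,
Literature.Probability.LatticeModels.messager_miracleSole_holds]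
#9 EtaOfDyadicLaw (support) — DIVIDEND (provable now, real analysis + in-tree MMS): DyadicScalingLaw
→ (∃ η, HasIsingExponentEta 3 η) ∧ (all-scale doubling ∃ κ > 0 ∀ n ≥ 1, κ g(n) ≤ g(2n)). Proof:
Cesàro on the dyadic ratios gives log g(2^k)/(k log 2) → −2Δ; sandwich 2^k ≤ n < 2^{k+1} by axis
monotonicity (MMS); all directions by the sup-norm comparison twoPointPlus_le_of_mul_supNorm_le
(g(3‖x‖_∞) ≤ G(x) ≤ g(⌊‖x‖_∞/3⌋)), so log G(x)/log ‖x‖ → −2Δ cofinitely, i.e. HasIsingExponentEta 3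
(2Δ − 1); doubling: g(2n)/g(n) → 4^{−Δ} > 0 plus positivity at small n
(criticalTwoPoint_bounds_holds). Closes item stmt-CriticalPhenomena-0635 once DyadicScalingLaw
lands. [difficulty: provable-now] [Literature.Probability.LatticeModels.HasIsingExponentEta,
Literature.Probability.LatticeModels.twoPointPlus_le_of_mul_supNorm_le,
Literature.Probability.LatticeModels.twoPointPlus_add_single_le, stmt-CriticalPhenomena-0635,
DuminilCopinICM2022 §4.2.1 p.12]
#9 NondegeneracyOfDoubling (support) — DIVIDEND: all-scale axis doubling ⇒ the non-degeneracy
transfer of item stmt-CriticalPhenomena-0667 (IsingCFTData r4, whose refuter notes identify doubling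
as exactly the missing input): if a pointwise scaling limit S of criticalCorr 3 with renormalisation
ρ > 0 has S 2 > 0 at ONE non-coincident pair then at every one. Proof sketch: S₂(x,y) = lim ρ(δ)²
G([x/δ]−[y/δ]); iterated doubling plus the sup-norm MMS comparison bound G at scale r/δ below by
c(r, r₀)·G at scale r₀/δ uniformly in δ, so the limit at separation r is ≥ c·s₀ > 0; local
uniformity absorbs the lattice floors. [difficulty: M] [stmt-CriticalPhenomena-0667 (refuter g3-2
and g3-3 notes of 2026-08-13),
Literature.Probability.LatticeModels.twoPointPlus_le_of_mul_supNorm_le,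
AizenmanDuminilCopinAnnals2021 §5.1 eq. (5.3)]
#9 AxisKallenLehmann (support) — DIVIDEND / shared tool: the axis Källén–Lehmann (Hausdorff-moment)
representation at criticality — a finite positive measure ν on [0,1] with g(n) = ∫ λⁿ dν for all n ≥
0 (g completely monotone, log-convex, non-increasing). From (R) with A = B = {0} by the spectral
theorem for the positive contraction T (Riesz–Markov applied to f ↦ ⟪ψ, f(T)ψ⟫, Mathlib CFC), or
from the torus spectral profile (TorusTransferSpectral) by weak limits. Wanted by cards
crossover-witness-no-doubling, rp-cannot-fix-the-scale-log-periodic,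
every-scale-regular-multiplicative-fekete, lattice-sdp-certificates, mirror-hoelder-modulus.
[difficulty: L] [GlimmJaffe1976 Prop 2.2, GlimmJaffe1977 §5 (Herglotz representation and spectral
weight near the bottom), AizenmanDuminilCopinAnnals2021 Prop 5.3, FrohlichSimonSpencer1976,
Literature.Probability.LatticeModels.TorusTransferSpectral (exists_spectralProfile)]

TWO-LAYER PLAN. Foreseen glued splits (nothing filed now; k ≤ 3, depth 1):
(V) ⇐ HomogeneousMourreSystem → ThresholdEgorovLemma → (V): (i) a self-adjoint (or weakly conjugate)
A on the OS space — first
moment Σ_b ⟨m_b, ·⟩ j_b of the exact energy current of the anisotropic/Hamiltonian-limit chain (or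
of a quasi-local log T), improved
by local first moments — with i[H, A] = cH + R, R AND [[H, A], A] H-small uniformly on rescaled
dyadic shells [E, 2E] (FGS 2011
template; auditor's points (2)–(3)) and Aψ geometric up to threshold-subdominant terms; (ii)
ThresholdEgorovLemma — abstract, no
lattice input: such (H ≥ 0, A, ψ) ⇒ V := e^{i(log 2/c)A} satisfies (Iso)(Int)(QP) (Duhamel +
commutator expansion; two-sided, never
Löwner-monotone). Alternative family (a separate route if pursued): block-spin isometry +
fixed-point convergence — meets
PositionSpaceRGNonGibbsian, not preferred. n-POINT FORM of (V) (the thesis 'scale covariance is an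
Egorov lemma', not filed: it needs a joint limit): for spin products σ_{A_m} with A_m = ⌊m·a⌋, a a
finite non-coincident configuration in ℝ², one V with V T^{⌊tm⌋} ψ_{A_m} ≈ 2^{|a|Δ} T^{2⌊tm⌋}
ψ_{A_{2m}}-type clauses uniformly in t ∈ [t₀, t₁] — scale covariance by 2 of all mixed two-plane
n-point functions; with transverse translations it feeds tightness/covariance items of the
covariance routes. Strengthening of DyadicScalingLaw once (V) moves: the factor-3 twin of (V) ⇒ full
regular variation g(λn)/g(n) → λ^{−2Δ}
(two incommensurable dilations kill log-periodicity) ⇒ existence of the axis two-point scaling limit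
(towards 0634 minus rotations).
(C) ⇐ [doubling ⇒ tightness + non-degeneracy (mirror-hoelder-modulus L1/L2)] → [isotropy:
HyperoctahedralRP] → [inversion:
InversionUpgradeNormalised] → [U₄: 0636] → (C) — owned by those routes.

KILL CRITERIA. DyadicScalingLaw refuted (two distinct dyadic limit points of g(2n)/g(n), or
non-existence of η) ⇒ (V) is false as well through the
glue and (R) — close `refuted:DyadicScalingLaw`; the witness re-scopes every card consuming
0635/0667. (V) refuted with the dyadic
law standing (an implementability obstruction, e.g. a proof that (Int)+(Iso) on the cyclic subspace
of ψ force exact dyadic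
self-similarity of ν incompatible with a lattice model) ⇒ ONE restate of (V) to a sequence of
approximate implementers V_m or to a
low-energy subspace, else close and hand the obstruction to the negatives index. (R) cannot fail
mathematically; a typing defect
(plusCorr junk, IsPositive convention, ℓ² embedding) is repaired by restate. Mooted: if 0634
(rotation-invariant pure power law) is
proved elsewhere, DyadicScalingLaw and both dividends follow without the engine — close `superseded`
unless (V) and its n-point form
(Two-layer plan) are wanted by a covariance route.

NOT DECOMPOSED YET. The CONSTRUCTION of V (Mourre system, second commutators, domains: A unbounded,
C^{1,1}(A) regularity uniformly on rescaled shells —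
auditor's points (2)–(3)); the abstract threshold-Egorov lemma; the vanishing of the lattice
β-function coefficient of Σ_x x·∂ε at
β_c (the ∂ε channel of the card) and the Δ_V > 3 virial channel; the Tauberian dictionary as
Literature facts (Karamata, de
Haan–Stadtmüller — only the elementary log-convexity/monotonicity version is used by the glue); the
factor-3 twin; transverse
translations/rotations; anything about U₄ or inversion (imported).

CHEAPEST FALSIFIER. (a) DyadicScalingLaw against data: g(n) at β_c(3) from published worm/MC
two-point data (n ≤ 128): g(2n)·4^Δ/g(n) with
Δ = 0.5181489 must be 1 + O(n^{−0.83}); a second dyadic limit point kills the hinge and, through the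
glue, the engine (kit job, hours; not run —
hub compute-free; MC literature consistent). (b) One dimension down (card test (b), typed form): for
the
critical 2D Ising transfer matrix (free fermions, Δ = 1/8; in tree IsingKaufman*, OnsagerToeplitz*)
build V from Kaufman's rotation
/ Koo–Saleur's L₀ + L̄₀ and check (Iso)(Int)(QP); no bounded V there ⇒ (V) is dead in 3D. (c)
Content of (V) on the cyclic subspace
L²(ν) of ψ (T = multiplication by λ): V := f ↦ 2^Δ f(λ²)ρ(λ) (ρ → 1 at λ = 1, ρ = 0 away from 1)
satisfies (Int) exactly and (QP),
is bounded iff the push-forward of ρ²ν under λ ↦ λ² is ≤ C·ν, and satisfies (Iso) iff 4^Δ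
g(4m)/g(2m) → 1: so (V) holds once ν is
dyadically self-similar near 1 with bounded Radon–Nikodym derivative ('no spectral staircase') —
strictly between DyadicScalingLaw and
regular variation; grade (V) as that spectral statement plus a promised Mourre-type proof; kill it
with an admissible ν defeating every bounded V.

NUMBERS. Bootstrap (PolandRychkovVichi2019): Δ_σ = 0.5181489(10), η = 0.036298(2), ω = 0.82968(23),
Δ_{σ′} = 5.2906(11) (quasi-primarity
corrections ∝ m^{−(Δ_{σ′}−Δ_σ)}), Δ_ε = 1.412625(10) (∂ε channel, must cancel at β_c); hence 4^{−Δ}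
= 0.48757 for DyadicScalingLaw. Rigorous: 1/2 ≤ Δ ≤ 1
(criticalTwoPoint_bounds_holds, scalingDimension_mem_Icc), η ≤ 1/2 if it exists
(DuminilcopinPanis2025 Thm 1.5); β_c(3) =
0.221654626(5) (MC). Items at open: 9 (4 crux, 4 support, 1 assembly).

DEFINITION REQUESTS. D1 (filed after open, kind definition, topic
Literature/Probability/LatticeModels, notion IsingAxisOSRealisation): the OS transfer
realisation of a translation-invariant, site- and bond-reflection-positive Gibbs measure on ℤ^d
along e₀ with T ≥ 0, as a
Literature construction + theorem (GlimmJaffe1987 Thm 6.1.3, FrohlichIsraelLiebSimon1978) — turns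
(R) into a named theorem and
serves cards quarter-turns-have-positive-roots, rotations-are-boosts-modular,
modular-timelike-kms-moebius. Later (layer 2, not filed):
Mourre vocabulary (C¹(A), Mourre estimate, LAP) under Literature/Analysis — Mathlib has none;
Karamata / de Haan–Stadtmüller
Tauberian facts (BGT Thms 1.7.1, 2.10.2; DehaanStadtmuller1985).

Novelty: Searches (2026-08-15): `lit search --source crossref` ×9 — "positive commutators spectrum
Pauli-Fierz threshold" (8: BachEtAl1999,
Golénia 2009 doi:10.1016/j.jfa.2008.12.016), "spectral renormalization group local decay
non-relativistic QED" (6: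
FrohlichGriesemerSigal2011, doi:10.1007/s00220-011-1339-1, doi:10.1016/j.jfa.2011.10.006), "Koo
Saleur formula lattice Virasoro"
(6: KooSaleur1994, MilstedVidal2017, doi:10.1007/jhep02(2021)130), "universal torus energy spectrum
three-dimensional Ising transfer
matrix" (6, none spectral-theoretic; SchulerEtAl2016 by doi), "unitary implementation of dilations
lattice quantum field theory
scaling limit" (6: surfaced Glimm–Jaffe 1976/1985), "Glimm Jaffe critical exponents and elementary
particles" (5), "phi4 single-phase
differentiability of the mass critical exponents" (5: doi:10.1103/physrevd.10.536), "scaling limit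
critical point transfer matrix
Hilbert space dilation generator" (6, none), "de Haan Stadtmuller O-regularly varying Laplace
transform Tauberian" (6:
DehaanStadtmuller1985); `lit read doi:10.1007/bf01609048` pp.1–4 and `doi:10.1007/bf01609482`
pp.1–3, 6–7 (read); `lit frontier
CriticalPhenomena --since 2020` (30 rows: SLE/percolation/lace, nothing spectral); `lit bridges
CriticalPhenomena --cross any` (30
rows; QuantumFields bridges via OS 1973 / ADC 2021 only); local searchd rc 1 (connection reset),
OpenAlex 429, galaxy queued > 90 s
this session (stated); ledger idea list (105 sibling cards) with full reads of every-scale  [refs: 10.1016/j.jfa.2008.12.016, 10.1007/s00220-011-1339-1, 10.1016/j.jfa.2011.10.006, 10.1007/jhep02(2021, 10.1103/physrevd.10.536, 10.1007/bf01609048`, 10.1007/bf01609482`, doi:10.1016/j.jfa.2008.12.016, doi:10.1007/s00220-011-1339-1, doi:10.1016/j.jfa.2011.10.006, doi:10.1007/jhep02, doi:10.1103/physrevd.10.536, doi:10.1007/bf01609048, doi:10.1007/bf01609482, BachEtAl1999, FrohlichGriesemerSigal2011,]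

Barriers (technique_class: conjugate-operator-threshold, os-transfer-operator): - technique_class: conjugate-operator-threshold, os-transfer-operator
- Literature.Barriers.CriticalPhenomena.ScaleCovarianceNotMoebius: not engaged by (R), (V),
DyadicScalingLaw (no symmetry upgrade from Euclidean data; V acts on the Ising OS space); (C)
inherits it unmitigated and says so — imported complement.
- Literature.Barriers.CriticalPhenomena.LiouvilleRigidity: not met — no planar maps; the engine is
dimension-free operator theory on the transfer-operator space; only (C) inherits it.
- Literature.Barriers.CriticalPhenomena.BootstrapLatticeBlindness: not met — no CFT/bootstrap input;
bootstrap numbers appear only under Numbers as targets for falsifiers.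
- Literature.Barriers.CriticalPhenomena.IsingTrivialityFromDimensionFour: (R), (V), DyadicScalingLaw
are dimension-uniform in form and presumably TRUE for every d ≥ 3 (d ≥ 5: Δ = (d−2)/2, Sakai2007) —
harmless, they concern clause (ii)'s exponent/regularity, not non-triviality; d = 3 enters only
through (C).
- Literature.Barriers.CriticalPhenomena.LongRangeTrivialityOnZ3: same remark; reflection-positive
long-range models on ℤ³ plausibly satisfy the analogue of (V) with Δ = (3−α)/2 while being Gaussian
— consistent, nothing here claims U₄ ≢ 0.
- Literature.Barriers.CriticalPhenomena.RigorousRGSmallParameter: it does not evade the absence of a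
small parameter; the bet is that IMPLEMENTABILITY of one dilation at low energy (an operator
identity system with o(1) errors, provable by commutator/locality estimates à la Mour

History (route lifecycle, newest last):
- 2026-08-16T14:03:51Z · rev 5: restated Assembly (stmt-CriticalPhenomena-6329 proved) — @edit_note.txt (planner-rground-CriticalPhenomena-ThresholdDila-d3e6bc50-0)
- 2026-08-22T03:39:47Z · DORMANT — reconciler: no traction for 5 d (last activity item-evidence-added at 2026-08-17T02:18:32Z); parked, not closed — `ledger route dormant route-CriticalPhenomena- (operator:999:917956)

sub-problem: Ising3DConformalLimit · status: dormant · opened planner-plancard-CriticalPhenomena-Ising3DCon-6161c610-0 2026-08-15T11:45:52Z · rev 7 · ledger route-CriticalPhenomena-ThresholdDilation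
GENERATED by the gate from the ledger (D-0016/17). Provers cite these decls: `theorem foo : Summit.CriticalPhenomena.Ising3DConformalLimit.Theses.ThresholdDilation.<Decl> := …` in Summits/CriticalPhenomena/Ising3DConformalLimit/Theorems/<Name>.lean.
-/

namespace Summit.CriticalPhenomena.Ising3DConformalLimit.Theses.ThresholdDilation

open scoped BigOperators Topology Manifold Classical MeasureTheory ProbabilityTheory Matrix InnerProductSpace ComplexConjugate ContinuousMap
open Filter Set Function TopologicalSpace MeasureTheory

attribute [summit_statement] _root_.Ising3DConformalLimit

/-- item stmt-CriticalPhenomena-6321 · crux · rank 2 · open · by planner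
why it might fail: A known theorem unproved in tree: T ≥ 0 needs BOTH site- and bond-reflection positivity of the infinite-volume state at β_c(3) exactly (torus RP → thermodynamic limit → β↑β_c via continuity/uniqueness, ADS2015) plus a GNS/RKHS completion into ℓ²; with one RP only, T ≥ 0 fails.
sources: GlimmJaffe1987 §6.1 Thm 6.1.3, GlimmJaffe1976 Prop 2.2 (spectral representation for the transfer matrix), FrohlichIsraelLiebSimon1978 §2–3, AizenmanDuminilCopinAnnals2021 Prop 5.3 (arXiv:1912.07973 p.17), Literature.Probability.LatticeModels.IsOSRealisation, Literature.Probability.LatticeModels.isingTorus_reflectionPositive_sites_holds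
[crux] (R) TWO-PLANE TRANSFER REALISATION (card M0; the unproved cone fact everything rests on — a
known theorem, filed FIRST by the plancard rule): on ℓ²(ℕ;ℂ) there are a positive contraction T (‖T‖
≤ 1, T ≥ 0, hence self-adjoint) and vectors ψ_A, A ranging over finite subsets of the time-zero
plane {x₀ = 0} ≅ ℤ², such that ⟪ψ_A, Tⁿ ψ_B⟫ = ⟨σ_A · σ_{B + n e₀}⟩⁺_{β_c(3),0} for all A, B, n
(plusCorr of the symmetric difference of A × {0} and B × {n}, σ² = 1). This is the
Osterwalder–Schrader space of the critical state for the site reflection x₀ ↦ −x₀ (positivity of the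
form), T the unit shift, T ≥ 0 by the bond reflection x₀ ↦ 1 − x₀ (n.n. Ising has both: FILS 1978;
in tree on tori isingTorus_reflectionPositive_sites/bonds_holds), embedded in separable ℓ². With A =
B = {0} it contains the axis Källén–Lehmann representation g(n) = ∫₀¹ λⁿ dν (support
AxisKallenLehmann). Proof route: GNS/RKHS completion of the RP kernel, T := shift, torus → ℤ³ → β_c
by weak limits (positivity is closed; plus = free state at β_c, ADS2015). [difficulty: L] -/
@[route_item "route-CriticalPhenomena-ThresholdDilation", crux]
def TwoPlaneTransferRealisation : Prop :=
  ∃ (T : lp (fun _ : ℕ => ℂ) 2 →L[ℂ] lp (fun _ : ℕ => ℂ) 2) (ψ : Finset (Fin 2 → ℤ) → lp (fun _ : ℕ => ℂ) 2), T.IsPositive ∧ ‖T‖ ≤ 1 ∧ ∀ (A B : Finset (Fin 2 → ℤ)) (n : ℕ), ⟪ψ A, (T ^ n) (ψ B)⟫_ℂ = ((Literature.Probability.LatticeModels.plusCorr 3 (Literature.Probability.LatticeModels.criticalBeta 3) 0 (symmDiff (Finset.image (fun y : Fin 2 → ℤ => (Matrix.vecCons (0 : ℤ) y : Fin 3 →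 ℤ)) A) (Finset.image (fun y : Fin 2 → ℤ => (Matrix.vecCons ((n : ℕ) : ℤ) y : Fin 3 → ℤ)) B)) : ℝ) : ℂ)

/-- item stmt-CriticalPhenomena-6322 · crux · rank 3 · open · by planner
why it might fail: No lattice symmetry x↦2x exists: V must be BUILT (Mourre conjugate operator from the energy-current first moment, or block spin at the fixed point) and needs a genuine scaling limit (no limit cycle), a gap above Δ_σ in the odd spectrum and corrections-to-scaling → 0 — all open on ℤ³.
sources: Mourre1981, BachEtAl1999 (threshold Mourre estimate with the dilation generator whose commutator with H_f is H_f), FrohlichGriesemerSigal2011 (spectral RG: LAP uniformly on rescaled dyadic shells), doi:10.1007/978-3-662-14145-8_18 (Boutet de Monvel–Măntoiu: weakly conjugate operator), KooSaleur1994, MilstedVidal2017 (lattice conformal generators from energy-current moments in 1+1D)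
[crux] (V) THRESHOLD DILATION IMPLEMENTER — the engine (card M1+M2+M3 in integrated form; the
hardest and most informative item; ranked 3 only because (R) must land first). For EVERY realisation
(T, ψ_·) as in (R), with ψ := ψ_{{0}} = σ̂₀Ω the spin at the origin, there are a bounded operator V
on ℓ² and Δ > 0 such that for every ε > 0, eventually in m: (Iso) |‖V T^m ψ‖ − ‖T^m ψ‖| ≤ ε ‖T^m ψ‖
(V is nearly isometric on the low-energy vectors T^m ψ = e^{−mH}ψ); (Int) ‖V T^m ψ − T^{2m} V ψ‖ ≤ ε
‖T^m ψ‖ (V intertwines one transfer step with two: the Egorov/integrated form of i[H, A] = (log 2)·H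
+ o(H), V ≈ e^{iA} implementing x ↦ 2x at low energy); (QP) ‖T^{2m}(V ψ − 2^{Δ} ψ)‖ ≤ ε ‖T^{2m} ψ‖
(after low-pass filtering the dilated spin is 2^Δ times the spin: σ is quasi-primary of weight Δ —
the consistent form of the card's (Q), whose literal 'Aψ = iΔ′ψ + χ' contradicts self-adjointness).
Existential in V on the OS space of the ACTUAL ℤ³ model: no local Hamiltonian or energy current is
presupposed (that construction is layer 2). Deliberately stated for the single spin: for a FIXED
lattice set A with |A| ≥ 2 the analogous clauses (V ψ_A ≈ 2^{|A|Δ} ψ_{2A}) would force exact scaling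
identiti -/
@[route_item "route-CriticalPhenomena-ThresholdDilation", crux]
def ThresholdDilationImplementer : Prop :=
  ∀ (T : lp (fun _ : ℕ => ℂ) 2 →L[ℂ] lp (fun _ : ℕ => ℂ) 2) (ψ : Finset (Fin 2 → ℤ) → lp (fun _ : ℕ => ℂ) 2), (T.IsPositive ∧ ‖T‖ ≤ 1 ∧ ∀ (A B : Finset (Fin 2 → ℤ)) (n : ℕ), ⟪ψ A, (T ^ n) (ψ B)⟫_ℂ = ((Literature.Probability.LatticeModels.plusCorr 3 (Literature.Probability.LatticeModels.criticalBeta 3) 0 (symmDiff (Finset.image (fun y : Fin 2 → ℤ => (Matrix.vecCons (0 : ℤ) y : Fin 3 → ℤ)) A) (Finset.image (fun y : Fin 2 → ℤ => (Matrix.vecCons ((n : ℕ) : ℤ) y : Fin 3 → ℤ)) B)) : ℝ) : ℂ)) → ∃ (V : lp (fun _ : ℕ => ℂ) 2 →L[ℂ] lp (fun _ : ℕ => ℂ) 2) (Δ : ℝ), 0 < Δ ∧ ∀ ε : ℝ, 0 < ε → ∀ᶠ m : ℕ in Filter.atTop, |‖V ((T ^ m) (ψ {0}))‖ - ‖(T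 ^ m) (ψ {0})‖| ≤ ε * ‖(T ^ m) (ψ {0})‖ ∧ ‖V ((T ^ m) (ψ {0})) - (T ^ (2 * m)) (V (ψ {0}))‖ ≤ ε * ‖(T ^ m) (ψ {0})‖ ∧ ‖(T ^ (2 * m)) (V (ψ {0}) - (((2 : ℝ) ^ Δ : ℝ) : ℂ) • (ψ {0}))‖ ≤ ε * ‖(T ^ (2 * m)) (ψ {0})‖

/-- item stmt-CriticalPhenomena-6323 · crux · rank 4 · open · by planner
why it might fail: Nothing two-point-shaped proves it: KL-positive crossover cascades pass RP, MMS, IR and DC–Panis bounds yet break doubling (card crossover-witness-no-doubling; item 0667 notes); in print only regular scales are abundant (arXiv:1912.07973 Thm 5.12). Numerically the limit is 1 (4^-Δ≈0.4876).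
sources: AizenmanDuminilCopinAnnals2021 §5.6 and Thm 5.12 (arXiv:1912.07973 p.20: regular scales abundant while all-scale regularity is open), DuminilcopinPanis2025 Thm 1.3 and Thm 1.5 (arXiv:2404.05700), stmt-CriticalPhenomena-0667 (refuter notes: doubling not derivable from RP/GKS/MMS), stmt-CriticalPhenomena-0635, PolandRychkovVichi2019 (Δ_σ = 0.5181489), Literature.Probability.LatticeModels.criticalTwoPoint_bounds_holds
[crux] DYADIC SCALING LAW of the critical two-point function along the axis (the hinge; output (O3)
of the card in its honest, discrete form): there is Δ > 0 with g(2n)·4^Δ / g(n) → 1 as n → ∞, g(n) =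
⟨σ₀σ_{ne₀}⟩⁺_{β_c(3)} = criticalTwoPoint 3 (n e₀). It implies η EXISTS in the log sense, η = 2Δ − 1
(item 0635; support EtaOfDyadicLaw) and ALL-SCALE DOUBLING g(2n) ≥ κ g(n) (⇒ item 0667, support
NondegeneracyOfDoubling); it is implied by the pure power law 0634 and by (R) ∧ (V) (support
DyadicLawOfImplementer). It does NOT assert regular variation g(λn)/g(n) → λ^{−2Δ} for all λ (a
log-periodic modulation of period log 2 survives; the factor-3 twin of (V) kills it, Two-layer
plan). Numerical target: 4^{−Δ} = 0.48757, corrections ∝ n^{−0.83}. [difficulty: open-problem] -/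
@[route_item "route-CriticalPhenomena-ThresholdDilation"]
def DyadicScalingLaw : Prop :=
  ∃ Δ : ℝ, 0 < Δ ∧ Filter.Tendsto (fun n : ℕ => Literature.Probability.LatticeModels.criticalTwoPoint 3 (Pi.single 0 ((2 * n : ℕ) : ℤ)) * (4 : ℝ) ^ Δ / Literature.Probability.LatticeModels.criticalTwoPoint 3 (Pi.single 0 ((n : ℕ) : ℤ))) Filter.atTop (nhds 1)

/-- item stmt-CriticalPhenomena-6324 · crux · rank 5 · open · by planner
why it might fail: It is the conjunct given only the two-point dyadic law: existence of all n-point limits, O(3) and inversion covariance and U₄≢0 stay open (ICM22 §8.4) and meet ScaleCovarianceNotMoebius/LiouvilleRigidity unmitigated; imported from HyperoctahedralRP, IsingEuclidUpgrade, AnomalousForces.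
sources: DuminilCopinICM2022 §8.1 p.25 and §8.4 p.29, PolandRychkovVichi2019 §II eq. (2), Literature.Barriers.CriticalPhenomena.ScaleCovarianceNotMoebius, Literature.Barriers.CriticalPhenomena.LiouvilleRigidity, stmt-CriticalPhenomena-0636, stmt-CriticalPhenomena-1344
[crux] (C) IMPORTED COMPLEMENT (lowest rank; this route does not attack it): the two-point dyadic
scaling law implies the conjunct Ising3DConformalLimit — i.e. given the two-point spine (η,
doubling, hence the admissible renormalisation ρ(δ) := g(⌊1/δ⌋)^{−1/2} with δ^{−Δ} behaviour in the
log sense, tightness and non-degeneracy transfer of subsequential limits), supply existence of the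
full pointwise limit, O(3) invariance, inversion covariance and U₄ ≢ 0. ONE implication, so that
whoever proves it may USE the dyadic law; its decomposition is owned by the covariance/U₄ routes
(HyperoctahedralRP isotropy; InversionUpgradeNormalised; item 0636; card mirror-hoelder-modulus for
doubling ⇒ equicontinuity ⇒ subsequential limits) — see Two-layer plan. [deps: DyadicScalingLaw]
[difficulty: open-problem] -/
@[route_item "route-CriticalPhenomena-ThresholdDilation", crux]
def ConformalLimitOfDyadicLaw : Prop :=
  (∃ Δ : ℝ, 0 < Δ ∧ Filter.Tendsto (fun n : ℕ => Literature.Probability.LatticeModels.criticalTwoPoint 3 (Pi.single 0 ((2 * n : ℕ) : ℤ)) * (4 : ℝ) ^ Δ / Literature.Probability.LatticeModels.criticalTwoPoint 3 (Pi.single 0 ((n : ℕ) : ℤ))) Filter.atTop (nhds 1)) → Ising3DConformalLimit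

/-- item stmt-CriticalPhenomena-6325 · support · rank 9 · closed · proved by Summit.CriticalPhenomena.Ising3DConformalLimit.ThresholdDilationGlue.dyadicLawOfImplementer_proof @ 1dd295dec660 (prover) · by planner
sources: idea card dilation-conjugate-operator-threshold (M3: the self-contained functional-analytic lemma), Literature.Probability.LatticeModels.criticalTwoPoint_bounds_holds, Literature.Probability.LatticeModels.twoPointPlus_add_single_le, Literature.Probability.LatticeModels.messager_miracleSole_holds
[support] GLUE (provable now, ~0.5–1 kLoC): (R) → (V) → DyadicScalingLaw. Proof: take (T, ψ_·) from
(R), ψ := ψ_{{0}}, and (V, Δ) from (V) (weight a = 2^Δ > 1); with u_m := T^m ψ, w_m := T^{2m} ψ the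
three inequalities give (a − ε)‖w_m‖ ≤ (1 + 2ε)‖u_m‖ and (1 − 2ε)‖u_m‖ ≤ (a + ε)‖w_m‖, so
‖u_m‖²/(a²‖w_m‖²) = g(2m)/(4^Δ g(4m)) → 1 (‖T^m ψ‖² = ⟪ψ, T^{2m}ψ⟫ = g(2m) by (R) with A = B = {0}:
plusCorr {0, 2m e₀} = criticalTwoPoint 3 (2m e₀) via spinProduct/spinPair and Matrix.vecCons k 0 =
Pi.single 0 k). Odd arguments: m ↦ g(2m) = ‖T^m ψ‖² is log-convex (Cauchy–Schwarz), so g(2m+2)/g(2m)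
is non-decreasing, ≤ 1 (MMS axis monotonicity twoPointPlus_add_single_le) and converges to 1 since
g(n) ≥ c n^{−2} (criticalTwoPoint_bounds_holds) forbids exponential decay; hence g(n+1)/g(n) → 1 and
g(4m+2)/g(2m+1) → 4^{−Δ}. No Tauberian theorem needed. [difficulty: provable-now] -/
@[route_item "route-CriticalPhenomena-ThresholdDilation"]
def DyadicLawOfImplementer : Prop :=
  Summit.CriticalPhenomena.Ising3DConformalLimit.Theses.ThresholdDilation.TwoPlaneTransferRealisation → Summit.CriticalPhenomena.Ising3DConformalLimit.Theses.ThresholdDilation.ThresholdDilationImplementer → Summit.CriticalPhenomena.Ising3DConformalLimit.Theses.ThresholdDilation.DyadicScalingLaw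

/-- item stmt-CriticalPhenomena-6326 · support · rank 9 · closed · proved by Summit.CriticalPhenomena.Ising3DConformalLimit.Theorems.ThresholdDilationEta.etaOfDyadicLaw_proof @ 0ea98118b10f (prover) · by planner
sources: Literature.Probability.LatticeModels.HasIsingExponentEta, Literature.Probability.LatticeModels.twoPointPlus_le_of_mul_supNorm_le, Literature.Probability.LatticeModels.twoPointPlus_add_single_le, stmt-CriticalPhenomena-0635, DuminilCopinICM2022 §4.2.1 p.12
[support] DIVIDEND (provable now, real analysis + in-tree MMS): DyadicScalingLaw → (∃ η,
HasIsingExponentEta 3 η) ∧ (all-scale doubling ∃ κ > 0 ∀ n ≥ 1, κ g(n) ≤ g(2n)). Proof: Cesàro on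
the dyadic ratios gives log g(2^k)/(k log 2) → −2Δ; sandwich 2^k ≤ n < 2^{k+1} by axis monotonicity
(MMS); all directions by the sup-norm comparison twoPointPlus_le_of_mul_supNorm_le (g(3‖x‖_∞) ≤ G(x)
≤ g(⌊‖x‖_∞/3⌋)), so log G(x)/log ‖x‖ → −2Δ cofinitely, i.e. HasIsingExponentEta 3 (2Δ − 1);
doubling: g(2n)/g(n) → 4^{−Δ} > 0 plus positivity at small n (criticalTwoPoint_bounds_holds). Closes
item stmt-CriticalPhenomena-0635 once DyadicScalingLaw lands. [difficulty: provable-now] -/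
@[route_item "route-CriticalPhenomena-ThresholdDilation"]
def EtaOfDyadicLaw : Prop :=
  Summit.CriticalPhenomena.Ising3DConformalLimit.Theses.ThresholdDilation.DyadicScalingLaw → (∃ η : ℝ, Literature.Probability.LatticeModels.HasIsingExponentEta 3 η) ∧ (∃ κ : ℝ, 0 < κ ∧ ∀ n : ℕ, 1 ≤ n → κ * Literature.Probability.LatticeModels.criticalTwoPoint 3 (Pi.single 0 ((n : ℕ) : ℤ)) ≤ Literature.Probability.LatticeModels.criticalTwoPoint 3 (Pi.single 0 ((2 * n : ℕ) : ℤ)))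

/-- item stmt-CriticalPhenomena-6327 · support · rank 9 · closed · proved by Summit.CriticalPhenomena.Ising3DConformalLimit.ThresholdDilationNondegeneracyOfDoubling.nondegeneracyOfDoubling_proof @ 6918b56b17fc (prover) · by planner
sources: stmt-CriticalPhenomena-0667 (refuter g3-2 and g3-3 notes of 2026-08-13), Literature.Probability.LatticeModels.twoPointPlus_le_of_mul_supNorm_le, AizenmanDuminilCopinAnnals2021 §5.1 eq. (5.3)
[support] DIVIDEND: all-scale axis doubling ⇒ the non-degeneracy transfer of item
stmt-CriticalPhenomena-0667 (IsingCFTData r4, whose refuter notes identify doubling as exactly the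
missing input): if a pointwise scaling limit S of criticalCorr 3 with renormalisation ρ > 0 has S 2
> 0 at ONE non-coincident pair then at every one. Proof sketch: S₂(x,y) = lim ρ(δ)² G([x/δ]−[y/δ]);
iterated doubling plus the sup-norm MMS comparison bound G at scale r/δ below by c(r, r₀)·G at scale
r₀/δ uniformly in δ, so the limit at separation r is ≥ c·s₀ > 0; local uniformity absorbs the
lattice floors. [difficulty: M] -/
@[route_item "route-CriticalPhenomena-ThresholdDilation"]
def NondegeneracyOfDoubling : Prop :=
  (∃ κ : ℝ, 0 < κ ∧ ∀ n : ℕ, 1 ≤ n → κ * Literature.Probability.LatticeModels.criticalTwoPoint 3 (Pi.single 0 ((n : ℕ) : ℤ)) ≤ Literature.Probability.LatticeModels.criticalTwoPoint 3 (Pi.single 0 ((2 * n : ℕ) : ℤ))) → ∀ (ρ : ℝ → ℝ) (S : Literature.Probability.LatticeModels.CorrFamily 3), (∀ δ ∈ Set.Ioc (0:ℝ) 1, 0 < ρ δ) → Literature.Probability.LatticeModels.HasPointwiseScalingLimit (Literature.Probability.LatticeModels.criticalCorr 3) ρ S → (∃ x ∈ Literature.Probability.LatticeModels.NonCoincident 3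 2, 0 < S 2 x) → Literature.Probability.LatticeModels.IsNondegenerateTwoPoint S

/-- item stmt-CriticalPhenomena-6328 · support · rank 9 · closed · proved by Summit.CriticalPhenomena.Ising3DConformalLimit.Theorems.axisKallenLehmann_proof @ b2d3e0ae4bc2 (prover) · by planner
sources: GlimmJaffe1976 Prop 2.2, GlimmJaffe1977 §5 (Herglotz representation and spectral weight near the bottom), AizenmanDuminilCopinAnnals2021 Prop 5.3, FrohlichSimonSpencer1976, Literature.Probability.LatticeModels.TorusTransferSpectral (exists_spectralProfile)
[support] DIVIDEND / shared tool: the axis Källén–Lehmann (Hausdorff-moment) representation at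
criticality — a finite positive measure ν on [0,1] with g(n) = ∫ λⁿ dν for all n ≥ 0 (g completely
monotone, log-convex, non-increasing). From (R) with A = B = {0} by the spectral theorem for the
positive contraction T (Riesz–Markov applied to f ↦ ⟪ψ, f(T)ψ⟫, Mathlib CFC), or from the torus
spectral profile (TorusTransferSpectral) by weak limits. Wanted by cards
crossover-witness-no-doubling, rp-cannot-fix-the-scale-log-periodic,
every-scale-regular-multiplicative-fekete, lattice-sdp-certificates, mirror-hoelder-modulus.
[difficulty: L] -/
@[route_item "route-CriticalPhenomena-ThresholdDilation"]
def AxisKallenLehmann : Prop :=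
  ∃ ν : MeasureTheory.Measure ℝ, MeasureTheory.IsFiniteMeasure ν ∧ ν (Set.Icc (0 : ℝ) 1)ᶜ = 0 ∧ ∀ n : ℕ, Literature.Probability.LatticeModels.criticalTwoPoint 3 (Pi.single 0 ((n : ℕ) : ℤ)) = ∫ t, t ^ n ∂ν

-- earlier Assembly (stmt-CriticalPhenomena-6329, replaced 2026-08-16T14:03:51Z -> stmt-CriticalPhenomena-15218): proved by Summit.CriticalPhenomena.Ising3DConformalLimit.Theorems.thresholdDilation_assembly_proof @ f1a4c209c52c — Summit.CriticalPhenomena.Ising3DConformalLimit.Theses.ThresholdDilation.TwoPlaneTransferRealisation → Summit.CriticalPhenomena.Ising3DConformalLimit.Theses.ThresholdDilation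
/-- item stmt-CriticalPhenomena-15218 · assembly · rank 1 · closed · proved by Summit.CriticalPhenomena.Ising3DConformalLimit.Theorems.thresholdDilation_assembly_proof @ 202f5fa901c1 (prover) · by planner
sources: idea card dilation-conjugate-operator-threshold, GlimmJaffe1987 §6.1, Mourre1981
[assembly] X → Statement for the thesis X = (R) ∧ (V) ∧ (C): TwoPlaneTransferRealisation →
ThresholdDilationImplementer → ConformalLimitOfDyadicLaw → Ising3DConformalLimit. NOT pure logic:
the step (R) ∧ (V) ⇒ DyadicScalingLaw is the functional-analytic glue (support
DyadicLawOfImplementer: three triangle inequalities on u_m = T^m ψ, w_m = T^{2m} ψ plus axis ratio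
regularity), which is used INSIDE the proof, not taken as a hypothesis; then (C) turns the dyadic
law into the conjunct. Provable now from the landed glue: `fun hR hV hC => hC
(ThresholdDilationGlue.dyadicLawOfImplementer_proof hR hV)` (planner evidence
AssemblyRestatedProof.lean, lean rc0, std axioms). Replaces the rev ≤ 4 form `(R) → (V) →
DyadicLawOfImplementer → (C) → Ising3DConformalLimit`, which was binder-for-binder the type of
`closes` and hence tauto-closable (ground.trivial). The deciding theorem `closes` is unchanged. -/
@[route_item "route-CriticalPhenomena-ThresholdDilation"]
def Assembly : Prop :=
  Summit.CriticalPhenomena.Ising3DConformalLimit.Theses.ThresholdDilation.TwoPlaneTransferRealisation → Summit.CriticalPhenomena.Ising3DConformalLimit.Theses.ThresholdDilation.ThresholdDilationImplementer → Summit.CriticalPhenomena.Ising3DConformalLimit.Theses.ThresholdDilation.ConformalLimitOfDyadicLaw → Ising3DConformalLimit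

/-! D-0027 §2.1 — DECIDING THEOREM (planner-authored via `route open/edit --closes-file`; by planner-rbadge-CriticalPhenomena-ThresholdDila-d3e6bc50-g2-0 2026-08-16T14:23:00Z):
its hypotheses are this route's items and its conclusion the sub-problem Statement (glue_lint), and it elaborates with this file. -/

@[closes "route-CriticalPhenomena-ThresholdDilation"] theorem closes
    (h_TwoPlaneTransferRealisation : TwoPlaneTransferRealisation)
    (h_ThresholdDilationImplementer : ThresholdDilationImplementer)
    (h_ConformalLimitOfDyadicLaw : ConformalLimitOfDyadicLaw) : _root_.Ising3DConformalLimit := by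
  -- Crux-only deciding theorem (route-repair 2026-08-16): binders = the cruxes (R), (V), (C). The glue
  -- (R) → (V) → DyadicScalingLaw (support DyadicLawOfImplementer; proved with std axioms in the
  -- Theorems module ThresholdDilationDyadicLawOfImplementer, which lies downstream of this file and so
  -- cannot be cited here) is re-proved INLINE as `hD`; then (C) turns the dyadic law into the conjunct.
  suffices hD : DyadicScalingLaw from h_ConformalLimitOfDyadicLaw hD
  obtain ⟨T, ψ, hpos, hnorm, hcorr⟩ := h_TwoPlaneTransferRealisation
  obtain ⟨V, Δ, hΔ, hev⟩ := h_ThresholdDilationImplementer T ψ ⟨hpos, hnorm, hcorr⟩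
  refine ⟨Δ, hΔ, ?_⟩
  -- folklore real analysis
  have tendsto_of_even_odd : ∀ {f : ℕ → ℝ} {l : Filter ℝ},
      Tendsto (fun m => f (2 * m)) atTop l → Tendsto (fun m => f (2 * m + 1)) atTop l →
        Tendsto f atTop l := by
    intro f l he ho
    rw [tendsto_atTop'] at he ho ⊢
    intro s hs
    obtain ⟨a, ha⟩ := he s hs
    obtain ⟨b, hb⟩ := ho s hs
    refine ⟨2 * max a b + 1, fun n hn => ?_⟩
    obtain ⟨k, hk | hk⟩ := Nat.even_or_odd' n
    · have hk' : max a b ≤ k := by omega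
      rw [hk]
      exact ha k (le_trans (le_max_left a b) hk')
    · have hk' : max a b ≤ k := by omega
      rw [hk]
      exact hb k (le_trans (le_max_right a b) hk')
  have tendsto_dyadic_of_even : ∀ {G : ℕ → ℝ}, (∀ n, 0 < G n) →
      Tendsto (fun k => G (k + 1) / G k) atTop (𝓝 1) → ∀ {B : ℝ},
        Tendsto (fun m => G (2 * (2 * m)) * B / G (2 * m)) atTop (𝓝 1) →
          Tendsto (fun n => G (2 * n) * B / G n) atTop (𝓝 1) := by
    intro G hGp hratio B heven
    have h4 : Tendsto (fun m : ℕ => 4 * m) atTop atTop :=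
      tendsto_atTop_mono (fun m => by dsimp only [id]; omega) tendsto_id
    have h41 : Tendsto (fun m : ℕ => 4 * m + 1) atTop atTop :=
      tendsto_atTop_mono (fun m => by dsimp only [id]; omega) tendsto_id
    have h2 : Tendsto (fun m : ℕ => 2 * m) atTop atTop :=
      tendsto_atTop_mono (fun m => by dsimp only [id]; omega) tendsto_id
    have e1 : Tendsto (fun m => G (4 * m + 1) / G (4 * m)) atTop (𝓝 1) := hratio.comp h4
    have e2 : Tendsto (fun m => G (4 * m + 1 + 1) / G (4 * m + 1)) atTop (𝓝 1) := hratio.comp h41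
    have e3 : Tendsto (fun m => G (2 * m + 1) / G (2 * m)) atTop (𝓝 1) := hratio.comp h2
    have hodd : Tendsto (fun m => G (2 * (2 * m + 1)) * B / G (2 * m + 1)) atTop (𝓝 1) := by
      have key := ((heven.mul e1).mul e2).div e3 one_ne_zero
      simp only [mul_one, div_one] at key
      refine key.congr fun m => ?_
      have p1 := hGp (2 * m)
      have p2 := hGp (4 * m)
      have p3 := hGp (4 * m + 1)
      have p4 := hGp (2 * m + 1)
      simp only [Pi.div_apply]
      rw [show 2 * (2 * m) = 4 * m by ring, show 2 * (2 * m + 1) = 4 * m + 1 + 1 by ring]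
      field_simp
    exact tendsto_of_even_odd heven hodd
  have tendsto_ratio_of_eventual_bounds : ∀ {U W : ℕ → ℝ} {A : ℝ}, 0 < A →
      (∀ m, 0 < U m) → (∀ m, 0 ≤ W m) →
        (∀ ε : ℝ, 0 < ε → ∀ᶠ m in atTop, |U m - A * W m| ≤ 2 * ε * U m + ε * W m) →
          Tendsto (fun m => A * W m / U m) atTop (𝓝 1) := by
    intro U W A hA hU hW h
    have key : ∀ ε : ℝ, 0 < ε →
        ∀ᶠ m in atTop, |1 - A * W m / U m| ≤ 2 * ε + ε / A * (A * W m / U m) := by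
      intro ε hε
      filter_upwards [h ε hε] with m hm
      have hUm := hU m
      rw [show 1 - A * W m / U m = (U m - A * W m) / U m by field_simp, abs_div, abs_of_pos hUm,
        div_le_iff₀ hUm]
      calc |U m - A * W m| ≤ 2 * ε * U m + ε * W m := hm
        _ = (2 * ε + ε / A * (A * W m / U m)) * U m := by field_simp
    have hbd : ∀ᶠ m in atTop, A * W m / U m ≤ 2 + 2 * A := by
      filter_upwards [key (A / 2) (half_pos hA)] with m hm
      have h1 := (abs_sub_le_iff.1 hm).2
      have h2 : A / 2 / A * (A * W m / U m) = (A * W m / U m) / 2 := by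
        field_simp
      rw [h2] at h1
      linarith
    refine Metric.tendsto_nhds.2 fun δ hδ => ?_
    have hε : 0 < δ * A / (2 * (4 * A + 2)) := by positivity
    filter_upwards [key _ hε, hbd] with m hm hb
    rw [Real.dist_eq, abs_sub_comm]
    have hx0 : 0 ≤ A * W m / U m := div_nonneg (mul_nonneg hA.le (hW m)) (hU m).le
    have hεA : 0 ≤ δ * A / (2 * (4 * A + 2)) / A := div_nonneg hε.le hA.le
    calc |1 - A * W m / U m|
        ≤ 2 * (δ * A / (2 * (4 * A + 2))) + δ * A / (2 * (4 * A + 2)) / A * (A * W m / U m) := hm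
      _ ≤ 2 * (δ * A / (2 * (4 * A + 2))) + δ * A / (2 * (4 * A + 2)) / A * (2 + 2 * A) := by
          gcongr
      _ = δ / 2 := by field_simp; ring
      _ < δ := half_lt_self hδ
  -- T ≥ 0 is self-adjoint: ‖Tⁿψ‖² = ⟪ψ, T²ⁿψ⟫
  have norm_pow_apply_sq : ∀ n : ℕ,
      ((‖(T ^ n) (ψ {0})‖ ^ 2 : ℝ) : ℂ) = ⟪ψ {0}, (T ^ (2 * n)) (ψ {0})⟫_ℂ := by
    intro n
    have hsa : IsSelfAdjoint (T ^ n) := hpos.isSelfAdjoint.pow n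
    have hin : ⟪(T ^ n) (ψ {0}), (T ^ n) (ψ {0})⟫_ℂ = ⟪ψ {0}, (T ^ (2 * n)) (ψ {0})⟫_ℂ := by
      rw [← ContinuousLinearMap.adjoint_inner_right, hsa.adjoint_eq]
      rw [show (T ^ n) ((T ^ n) (ψ {0})) = (T ^ (2 * n)) (ψ {0}) by rw [two_mul, pow_add]; rfl]
    rw [← hin, inner_self_eq_norm_sq_to_K]
    push_cast
    rfl
  -- (R) at A = B = {0} computes g(k) = ⟨σ₀σ_{k e₀}⟩⁺_{β_c(3)}
  have plusCorr_symmDiff_axis : ∀ k : ℕ,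
      Literature.Probability.LatticeModels.plusCorr 3 (Literature.Probability.LatticeModels.criticalBeta 3) 0
          (symmDiff (Finset.image (fun y : Fin 2 → ℤ => (Matrix.vecCons (0 : ℤ) y : Fin 3 → ℤ)) {0})
            (Finset.image (fun y : Fin 2 → ℤ => (Matrix.vecCons ((k : ℕ) : ℤ) y : Fin 3 → ℤ)) {0}))
        = Literature.Probability.LatticeModels.criticalTwoPoint 3 (Pi.single 0 (k : ℤ)) := by
    intro k
    rw [Finset.image_singleton, Finset.image_singleton, Matrix.cons_zero_zero]
    have hv : (Matrix.vecCons ((k : ℕ) : ℤ) (0 : Fin 2 → ℤ) : Fin 3 → ℤ) = Pi.single 0 (k : ℤ) := by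
      funext i
      refine Fin.cases ?_ (fun j => ?_) i
      · simp
      · simp [Fin.succ_ne_zero]
    rw [hv]
    unfold Literature.Probability.LatticeModels.plusCorr Literature.Probability.LatticeModels.criticalTwoPoint Literature.Probability.LatticeModels.twoPointPlus
    congr 1
    funext s
    by_cases h0 : (Pi.single 0 (k : ℤ) : Fin 3 → ℤ) = 0
    · rw [h0, symmDiff_self]
      simp [Literature.Probability.LatticeModels.spinProduct, Literature.Probability.LatticeModels.spinPair]
    · have hset : symmDiff ({0} : Finset (Fin 3 → ℤ)) {Pi.single 0 (k : ℤ)}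
          = {0, Pi.single 0 (k : ℤ)} := by
        ext x
        rw [Finset.mem_symmDiff]
        simp only [Finset.mem_singleton, Finset.mem_insert]
        constructor
        · rintro (⟨h1, -⟩ | ⟨h1, -⟩)
          · exact Or.inl h1
          · exact Or.inr h1
        · rintro (h1 | h1)
          · exact Or.inl ⟨h1, fun h2 => h0 (h2.symm.trans h1)⟩
          · exact Or.inr ⟨h1, fun h2 => h0 (h1.symm.trans h2)⟩
      rw [hset]
      simp only [Literature.Probability.LatticeModels.spinProduct, Literature.Probability.LatticeModels.spinPair]
      rw [Finset.prod_pair (Ne.symm h0)]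
  -- g > 0 (Simon–Lieb), ⟪ψ, Tᵏψ⟫ = g(k), ‖Tᵐψ‖² = g(2m) > 0
  set G : ℕ → ℝ := fun n => Literature.Probability.LatticeModels.criticalTwoPoint 3 (Pi.single 0 (n : ℤ)) with hG
  have hGpos : ∀ n, 0 < G n := by
    intro n
    show 0 < Literature.Probability.LatticeModels.criticalTwoPoint 3 (Pi.single 0 (n : ℤ))
    by_cases hx : (Pi.single 0 (n : ℤ) : Literature.Probability.LatticeModels.Site 3) = 0
    · rw [hx, Literature.Probability.LatticeModels.criticalTwoPoint_zero']
      exact one_pos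
    · obtain ⟨c, C, hc, hb⟩ := Literature.Probability.LatticeModels.criticalTwoPoint_bounds_holds (d := 3) le_rfl
      exact lt_of_lt_of_le (mul_pos hc (Real.rpow_pos_of_pos (norm_pos_iff.2 hx) _)) (hb _ hx).1
  have hinner : ∀ k : ℕ, ⟪ψ {0}, (T ^ k) (ψ {0})⟫_ℂ = ((G k : ℝ) : ℂ) := by
    intro k
    rw [hcorr {0} {0} k, plusCorr_symmDiff_axis]
  have hnormsq : ∀ n : ℕ, ‖(T ^ n) (ψ {0})‖ ^ 2 = G (2 * n) := by
    intro n
    have h := norm_pow_apply_sq n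
    rw [hinner] at h
    exact_mod_cast h
  have hUpos : ∀ m : ℕ, 0 < ‖(T ^ m) (ψ {0})‖ := by
    intro m
    have h2 : 0 < ‖(T ^ m) (ψ {0})‖ ^ 2 := by
      rw [hnormsq m]
      exact hGpos _
    rcases (norm_nonneg ((T ^ m) (ψ {0}))).lt_or_eq with hlt | heq
    · exact hlt
    · rw [← heq] at h2
      norm_num at h2
  have hApos : 0 < (2 : ℝ) ^ Δ := Real.rpow_pos_of_pos two_pos Δ
  -- (Iso)+(Int)+(QP): |‖Tᵐψ‖ − 2^Δ‖T²ᵐψ‖| ≤ 2ε‖Tᵐψ‖ + ε‖T²ᵐψ‖ eventually, so 2^Δ‖T²ᵐψ‖/‖Tᵐψ‖ → 1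
  have hineq : ∀ ε : ℝ, 0 < ε → ∀ᶠ m in atTop,
      |‖(T ^ m) (ψ {0})‖ - (2 : ℝ) ^ Δ * ‖(T ^ (2 * m)) (ψ {0})‖|
        ≤ 2 * ε * ‖(T ^ m) (ψ {0})‖ + ε * ‖(T ^ (2 * m)) (ψ {0})‖ := by
    intro ε hε
    filter_upwards [hev ε hε] with m hm
    obtain ⟨hiso, hint, hqp⟩ := hm
    have hlin : (T ^ (2 * m)) (V (ψ {0}) - (((2 : ℝ) ^ Δ : ℝ) : ℂ) • ψ {0})
        = (T ^ (2 * m)) (V (ψ {0})) - (((2 : ℝ) ^ Δ : ℝ) : ℂ) • (T ^ (2 * m)) (ψ {0}) := by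
      rw [map_sub, map_smul]
    rw [hlin] at hqp
    have hsmul : ‖(((2 : ℝ) ^ Δ : ℝ) : ℂ) • (T ^ (2 * m)) (ψ {0})‖
        = (2 : ℝ) ^ Δ * ‖(T ^ (2 * m)) (ψ {0})‖ := by
      rw [norm_smul, Complex.norm_real, Real.norm_of_nonneg hApos.le]
    have htri : |‖V ((T ^ m) (ψ {0}))‖ - (2 : ℝ) ^ Δ * ‖(T ^ (2 * m)) (ψ {0})‖|
        ≤ ε * ‖(T ^ m) (ψ {0})‖ + ε * ‖(T ^ (2 * m)) (ψ {0})‖ := by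
      rw [← hsmul]
      calc |‖V ((T ^ m) (ψ {0}))‖ - ‖(((2 : ℝ) ^ Δ : ℝ) : ℂ) • (T ^ (2 * m)) (ψ {0})‖|
          ≤ ‖V ((T ^ m) (ψ {0})) - (((2 : ℝ) ^ Δ : ℝ) : ℂ) • (T ^ (2 * m)) (ψ {0})‖ :=
            abs_norm_sub_norm_le _ _
        _ ≤ ‖V ((T ^ m) (ψ {0})) - (T ^ (2 * m)) (V (ψ {0}))‖
              + ‖(T ^ (2 * m)) (V (ψ {0})) - (((2 : ℝ) ^ Δ : ℝ) : ℂ) • (T ^ (2 * m)) (ψ {0})‖ :=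
            norm_sub_le_norm_sub_add_norm_sub _ _ _
        _ ≤ ε * ‖(T ^ m) (ψ {0})‖ + ε * ‖(T ^ (2 * m)) (ψ {0})‖ := add_le_add hint hqp
    have h1 := abs_sub_le_iff.1 hiso
    have h2 := abs_sub_le_iff.1 htri
    rw [abs_sub_le_iff]
    constructor <;> linarith [h1.1, h1.2, h2.1, h2.2]
  have hlim := tendsto_ratio_of_eventual_bounds (U := fun m => ‖(T ^ m) (ψ {0})‖)
    (W := fun m => ‖(T ^ (2 * m)) (ψ {0})‖) hApos hUpos (fun m => norm_nonneg _) hineq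
  -- even arguments: g(4m)·4^Δ/g(2m) = (2^Δ‖T²ᵐψ‖/‖Tᵐψ‖)² → 1
  have heven : Tendsto (fun m => G (2 * (2 * m)) * (4 : ℝ) ^ Δ / G (2 * m)) atTop (𝓝 1) := by
    have h2 := hlim.pow 2
    rw [one_pow] at h2
    refine h2.congr fun m => ?_
    have hU2 : ‖(T ^ m) (ψ {0})‖ ^ 2 = G (2 * m) := hnormsq m
    have hW2 : ‖(T ^ (2 * m)) (ψ {0})‖ ^ 2 = G (2 * (2 * m)) := hnormsq (2 * m)
    have hA2 : ((2 : ℝ) ^ Δ) ^ 2 = (4 : ℝ) ^ Δ := by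
      rw [← Real.rpow_natCast, ← Real.rpow_mul (by norm_num : (0 : ℝ) ≤ 2), mul_comm,
        Real.rpow_mul (by norm_num : (0 : ℝ) ≤ 2)]
      norm_num
    rw [div_pow, mul_pow, hU2, hW2, hA2]
    ring
  -- odd arguments: in-tree axis ratio regularity g(k+1)/g(k) → 1
  have hratio : Tendsto (fun k => G (k + 1) / G k) atTop (𝓝 1) :=
    Literature.Probability.LatticeModels.criticalTwoPoint_axis_ratio_tendsto_one' (0 : Fin 3)
  exact tendsto_dyadic_of_even hGpos hratio heven

end Summit.CriticalPhenomena.Ising3DConformalLimit.Theses.ThresholdDilation
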